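import Mathlib.Data.ZMod.Basic
import Mathlib.Algebra.GroupWithZero.Units.Basic
import Literature.IUT.HodgeTheaters.Labels
import Literature.IUT.HodgeTheaters.LabelsPlusMinus
import HarnessLib

/-!
# [IUTchI] §6, Remarks 6.12.5 and 6.12.6: the zero label, "insulation", geometric versus
# arithmetic basepoints (abc-iut cell, layer L5, wave-2 row W2-L5-03b)

Mochizuki, *Inter-universal Teichmüller theory I: construction of Hodge theaters*, §6 "Additive
combinatorial Teichmüller theory", kurims FINAL MANUSCRIPT (May 2020; lit key
`paper:url-690e7b3c6199`, PDF page = printed page), Remark 6.12.5 (i)–(iii) pp. 179–180 and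
Remark 6.12.6 (i)–(v) pp. 180–182 — the expository tail of §6 after Corollary 6.12. Remarks
6.12.1/6.12.2 and Definition 6.13 are typed by abc-iut-L5-t4 (`ThetaPMEllHodgeTheaters.lean`,
pending), Remarks 6.12.3/6.12.4 (upper-half-plane "combinatorial prototypes", Fig. 6.4, label
synchronization) by abc-iut-L5-t6 (`PMTheatersRemarksA.lean`), and the matrix-group content of Remark
6.12.6 (iv) (Borel versus semi-unipotent in `SL₂(𝔽_l)`, PROVED) is the sibling file `BorelSL2.lean`.
One `/-! -/` section per printed sub-item, each with its locator.

WHAT IS TYPED, AND HOW. Both Remarks compare the `𝔽_l^⋇`-symmetry of §4 (`𝔽_l^⋇ = 𝔽_lˣ/{±1}` on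
the NONZERO labels; `Labels.lean`: `FlStar`, `FlAbs = |𝔽_l|`) with the `𝔽_l^{⋊±}`-symmetry of §6
(`𝔽_l ⋊ {±1}` acting on ALL of `𝔽_l` by `z ↦ ±z + λ`; `LabelsPlusMinus.lean`: `FlPM` and its
`MulAction` on `ZMod l`). Sentences stating something checkable about these finite objects are typed
as REAL statements over those tree definitions and PROVED (namespace `ZeroLabel`): Rmk 6.12.5 (i)
"inclusion of the zero element … allows one to relate the zero-labeled prime-strip to the various
nonzero-labeled prime-strips" = the `𝔽_l^{⋊±}`-orbit of the label `0` is all of `𝔽_l`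
(`orbit_zero_eq_univ`, `isPretransitive`), while under units (through which `𝔽_l^⋇` acts) the orbit
of `0` is `{0}` and nonzero labels stay nonzero (`units_orbit_zero`, `units_smul_ne_zero`); Rmk 6.12.5
(ii) "does not allow one to insulate the non-zero-labeled prime-strips from confusion with the
zero-labeled prime-strip" = a nonempty `𝔽_l^{⋊±}`-stable set of labels is everything, and the set of
nonzero labels is not stable (`eq_univ_of_stable`, `zero_mem_of_stable`, `nonzero_not_stable`).
The other sub-items (6.12.5 (iii); 6.12.6 (i)(ii)(iii)(v)) are explanatory prose about objects typed
elsewhere (`Θ^{±ell}NF`-Hodge theaters, `𝒟^{⊚±}`, `𝕍^±`, `𝕍^{Bor}`, the étale theta function,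
`F_mod` of Ex 5.1): INDEXED below with locator + précis (status 'noted') and pointers to the
declarations they speak about; no hypothesis-structure slots are introduced (none of them states a
relation between already-typed objects that Lean could check).

Record-only: [claim: Mochizuki2012, status: disputed] on every declaration; nothing here asserts or
uses any disputed claim, and nothing takes a side on [IUTchIII] Cor. 3.12.
-/

namespace Literature.IUT.HodgeTheaters

/-! ## Remark 6.12.5 (i) ([IUTchI] pp. 179–180): the zero element is included in the `𝔽_l^{⋊±}`-symmetry

Précis: "One fundamental difference between the `𝔽_l^⋇`-symmetry of §4 and the `𝔽_l^{⋊±}`-symmetry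
of the present §6 lies in the inclusion of the zero element `∈ 𝔽_l` in the symmetry under
consideration", which "allows one to relate the "zero-labeled" prime-strip to the various
"nonzero-labeled" prime-strips, i.e., the prime-strips labeled by nonzero elements `∈ 𝔽_l` [or,
essentially equivalently, `∈ 𝔽_l^⋇`]" (= the decomposition `|𝔽_l| = 0 ∪ 𝔽_l^⋇`, `Labels.lean`
`flAbsEquivOption`), in a "combinatorially holomorphic" fashion (compatibly with the bijections `†ζ`
to global `±`-label classes of cusps, Rmk 6.12.4 (ii) — abc-iut-L5-t6); evaluation at the
zero-labeled cusps matters for the normalization of the étale theta function ([EtTh] Thm 1.10;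
[IUTchII]). The checkable kernel (zero and nonzero labels in ONE orbit of `𝔽_l^{⋊±}`, versus `0`
fixed by the multiplicative symmetry) is proved below; the rest is indexed only. -/

namespace ZeroLabel

variable (l : ℕ)

/-- **Rmk 6.12.5 (i), the additive side**: the `𝔽_l^{⋊±}`-symmetry relates the zero label to EVERY
label — for each `x ∈ 𝔽_l` the translation `z ↦ z + x` (a positive element of `𝔽_l^{⋊±}`,
`FlPM.transl`) carries `0` to `x`. ([IUTchI] Rmk 6.12.5 (i), p. 179)
[claim: Mochizuki2012, status: disputed] -/
theorem exists_smul_zero_eq (x : ZMod l) : ∃ g : FlPM l, g • (0 : ZMod l) = x :=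
  ⟨FlPM.transl x, by simp⟩

/-- **Rmk 6.12.5 (i)**: the action of `𝔽_l^{⋊±}` on the label set `𝔽_l` ([IUTchI] Def 6.1 (i)) is
transitive — any label is related to any other by the symmetry ("network of comparison
isomorphisms", Rmk 6.12.4 (i)). ([IUTchI] Rmk 6.12.5 (i), p. 179)
[claim: Mochizuki2012, status: disputed] -/
theorem isPretransitive : MulAction.IsPretransitive (FlPM l) (ZMod l) :=
  ⟨fun x y => ⟨FlPM.transl (y - x), by simp⟩⟩

/-- **Rmk 6.12.5 (i)**, orbit form: the `𝔽_l^{⋊±}`-orbit of the zero label is the whole of `𝔽_l`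
(zero-labeled and nonzero-labeled strips lie in one orbit). ([IUTchI] Rmk 6.12.5 (i), p. 179)
[claim: Mochizuki2012, status: disputed] -/
theorem orbit_zero_eq_univ : MulAction.orbit (FlPM l) (0 : ZMod l) = Set.univ :=
  Set.eq_univ_of_forall fun x => MulAction.mem_orbit_iff.2 (exists_smul_zero_eq l x)

/-- **Rmk 6.12.5 (i), the multiplicative side for contrast**: under the multiplicative symmetry of
§4 — units of `𝔽_l` acting by multiplication, through which `𝔽_l^⋇ = 𝔽_lˣ/{±1}` acts on
`|𝔽_l| = 𝔽_l/{±1}` — the zero label is FIXED: its orbit is `{0}`. (This is the sense in which the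
`𝔽_l^⋇`-symmetry "does not include the zero element".) ([IUTchI] Rmk 6.12.5 (i), p. 179)
[claim: Mochizuki2012, status: disputed] -/
theorem units_orbit_zero : MulAction.orbit (ZMod l)ˣ (0 : ZMod l) = {0} := by
  ext x
  rw [MulAction.mem_orbit_iff, Set.mem_singleton_iff]
  constructor
  · rintro ⟨u, rfl⟩
    exact smul_zero u
  · rintro rfl
    exact ⟨1, smul_zero 1⟩

/-- **Rmk 6.12.5 (i)/(ii), multiplicative side**: a unit never carries a nonzero label to the zero
label — under the `𝔽_l^⋇`-symmetry the nonzero labels are "insulated" from the zero label.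
([IUTchI] Rmk 6.12.5 (i)(ii), pp. 179–180) [claim: Mochizuki2012, status: disputed] -/
theorem units_smul_ne_zero (u : (ZMod l)ˣ) {x : ZMod l} (hx : x ≠ 0) : u • x ≠ 0 := by
  rw [Units.smul_def, smul_eq_mul, Ne, Units.mul_right_eq_zero]
  exact hx

/-! ## Remark 6.12.5 (ii) ([IUTchI] p. 180): no "insulation" of the nonzero labels

Précis: the `𝔽_l^{⋊±}`-symmetry "has the [tautological!] disadvantage that it does not allow one to
"insulate" the non-zero-labeled prime-strips from confusion with the zero-labeled prime-strip",
an issue "of substantial importance in the theory of Gaussian Frobenioids [to be developed in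
[IUTchII]], i.e., Frobenioids that, roughly speaking, arise from the theta values `{q_v^{j²}}_j` [cf.
Example 4.4, (i)] at the non-zero-labeled evaluation points", which [IUTchII], [IUTchIII] relate to
"global arithmetic line bundles on the number field `F`" using "both the additive and the
multiplicative structures" (hence §5). Kernel proved below: no set of labels avoiding `0` is stable
under `𝔽_l^{⋊±}`. The theta values `q^{j²}` belong to [IUTchI] Ex 4.4 (i) (abc-iut-L5-t3) and [IUTchII]
(abc-iut-L6-t2 `thetaValueAt`); Gaussian Frobenioids / line bundles are layer-L6 objects. -/

/-- **Rmk 6.12.5 (ii), kernel**: a nonempty set of labels `S ⊆ 𝔽_l` stable under the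
`𝔽_l^{⋊±}`-symmetry is all of `𝔽_l` — the symmetry admits no proper invariant block of labels.
([IUTchI] Rmk 6.12.5 (ii), p. 180) [claim: Mochizuki2012, status: disputed] -/
theorem eq_univ_of_stable {S : Set (ZMod l)}
    (hS : ∀ (g : FlPM l) (x : ZMod l), x ∈ S → g • x ∈ S) (hne : S.Nonempty) : S = Set.univ := by
  obtain ⟨x₀, hx₀⟩ := hne
  refine Set.eq_univ_of_forall fun x => ?_
  simpa using hS (FlPM.transl (x - x₀)) x₀ hx₀

/-- **Rmk 6.12.5 (ii)**: in particular every nonempty `𝔽_l^{⋊±}`-stable set of labels CONTAINS the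
zero label — the nonzero-labeled strips cannot be "insulated from confusion with the zero-labeled
prime-strip". ([IUTchI] Rmk 6.12.5 (ii), p. 180) [claim: Mochizuki2012, status: disputed] -/
theorem zero_mem_of_stable {S : Set (ZMod l)}
    (hS : ∀ (g : FlPM l) (x : ZMod l), x ∈ S → g • x ∈ S) (hne : S.Nonempty) : (0 : ZMod l) ∈ S := by
  rw [eq_univ_of_stable l hS hne]
  trivial

/-- **Rmk 6.12.5 (ii)**, concretely: for `l > 1` the set of NONZERO labels is not preserved by the
`𝔽_l^{⋊±}`-symmetry (the translation by `1` carries the nonzero label `−1` to `0`) — contrast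
`units_smul_ne_zero` for the `𝔽_l^⋇`-symmetry of §4. ([IUTchI] Rmk 6.12.5 (ii), p. 180)
[claim: Mochizuki2012, status: disputed] -/
theorem nonzero_not_stable [Fact (1 < l)] :
    ¬ ∀ (g : FlPM l) (x : ZMod l), x ≠ 0 → g • x ≠ 0 := by
  intro h
  exact h (FlPM.transl 1) (-1) (neg_ne_zero.mpr one_ne_zero) (by simp)

end ZeroLabel

/-! ## Remark 6.12.5 (iii) ([IUTchI] p. 180) — noted (prose)

Précis: "since … we shall not be interested in analogues of the Gaussian Frobenioids that involve the
zero-labeled evaluation points, we shall not require an "additive analogue" of the portion [cf.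
Example 5.1] of the theory developed in §5 concerning global Frobenioids." Statement of intent about
[IUTchII]; Ex 5.1 = abc-iut-L5-t1 `GlobalFrobenioids*.lean`. Nothing to type. -/

/-! ## Remark 6.12.6 (i) ([IUTchI] p. 180) — noted (prose; pointers)

Précis: a second "fundamental difference" is "the geometric nature of the "single basepoint"" of the
`𝔽_l^{⋊±}`-symmetry: the labels `∈ T ⥲ 𝔽_l` of a [`𝒟`-]`Θ^{±ell}`-Hodge theater "correspond … to
collections of cusps in a single copy [i.e., connected component] of "`𝒟_v`" at each `v ∈ 𝕍`; these
collections of cusps are permuted by the `𝔽_l^{⋊±}`-symmetry of the [`𝒟`-]`Θ^{ell}`-bridge [cf.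
Proposition 6.8, (i)] without permuting the collection of valuations `𝕍^± (⊆ 𝕍(K))` [cf. …
Definition 6.1, (v)]. This contrasts sharply with the arithmetic nature of the "single basepoint" …
of §4, i.e., in the sense that the `𝔽_l^⋇`-symmetry [cf. Proposition 4.9, (i)] permutes the various
`𝔽_l^⋇`-translates of `𝕍^± = 𝕍^{±un} ⊆ 𝕍^{Bor} (⊆ 𝕍(K))` [cf. Example 4.3, (i); Remark 6.1.1]."
Objects: `𝕍^{Bor}`, `𝕍^{±un}`, Prop 4.9 (i) = abc-iut-L5-t3 (`VBor`, `VPlusMinusUn`, `Prop49i`,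
staged); `𝕍^±`, `𝒟^{⊚±}`, Prop 6.8 (i) = abc-iut-L5-t4 (`PMBase*`, pending). A comparison of WHERE two
typed group actions act (cusps of one `𝒟_v` vs. subsets of `𝕍(K)`), not a new relation; noted. -/

/-! ## Remark 6.12.6 (ii) ([IUTchI] p. 180) — noted (prose)

Précis: this geometric "single basepoint" "is more suited to the theory of the Hodge-Arakelov-theoretic
evaluation of the étale theta function to be developed in [IUTchII], in which the existence of a
"single basepoint" corresponding to a single connected component of "`𝒟_v`" for `v ∈ 𝕍^{bad}` plays
a central role." Motivation for [IUTchII] §2 (layer L6, abc-iut-L6-t1); nothing to type. -/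

/-! ## Remark 6.12.6 (iii) ([IUTchI] pp. 180–181) — noted (prose; the rigidity it names is typed)

Précis: "By contrast, the arithmetic nature of the "single basepoint" of the `𝔽_l^⋇`-symmetry of a
[`𝒟`-]`ΘNF`-Hodge theater … is more suited to the explicit construction of the number field `F_mod`
[cf. Example 5.1] — i.e., to the construction of an object which is invariant with respect to the
`Aut(C_K)/Aut_ε(C_K) ⥲ 𝔽_l^⋇`-symmetries" of Ex 4.3 (iv); attempting the Ex 5.1 construction with the
copy of `𝒟^{⊚±}` of a [`𝒟`-]`Θ^{ell}`-bridge "one must sacrifice the crucial rigidity with respect to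
`Aut(𝒟^{⊚±})/Aut_±(𝒟^{⊚±}) ⥲ 𝔽_l^⋇` [cf. Definition 6.1, (v)]" coming from the definition of a
[`𝒟`-]`Θ^{ell}`-bridge (Ex 6.3; Def 6.4 (ii)); without this `𝔽_l^⋇`-rigidity the symmetry is no longer
defined relative to a single copy of "`𝒟_v`" at each `v` (a "single geometric basepoint") and is "no
longer compatible" with the theta evaluation of [IUTchII] [cf. (ii)]. The two quotients onto `𝔽_l^⋇`
named here are, in matrix form, Borel modulo semi-unipotent-up-to-`±1`:
`BorelLabels.borelQuotientEquiv` (GL₂-form of Ex 4.3 (i), abc-iut-L5-t3; `Aut(C_K)` form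
`quotientAutEpsEquiv`) and, inside `SL₂(𝔽_l)`, `SL2.borelSL`/`SL2.semiUnipSL` of (iv) below;
`F_mod` = Ex 5.1 (abc-iut-L5-t1). -/


/-! ## Remark 6.12.6 (iv) ([IUTchI] p. 181) — typed and PROVED in `BorelSL2.lean`

"whereas the Borel subgroup `{(* *; 0 *)} ⊆ SL₂(𝔽_l)` is normally terminal in `SL₂(𝔽_l)` …, the
"semi-unipotent" subgroup `{(±1 *; 0 ±1)} ⊆ SL₂(𝔽_l)` … fails to be normally terminal in
`SL₂(𝔽_l)`": `SL2.borelSL_isNormallyTerminal`, `SL2.normalizer_semiUnipSL`,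
`SL2.not_isNormallyTerminal_semiUnipSL`, `SL2.rmk6126_iv` (sibling file, same directory). -/

/-! ## Remark 6.12.6 (v) ([IUTchI] pp. 181–182) — noted (prose summary)

Précis: "taken as a whole, a [`𝒟`-]`Θ^{±ell}NF`-Hodge theater [cf. Remark 6.12.2, (ii)] may be
thought of as a sort of "intricate relay between geometric and arithmetic basepoints" that allows
one to carry out, in a consistent fashion, both (a) the theory of the Hodge-Arakelov-theoretic
evaluation of the étale theta function to be developed in [IUTchII] [cf. (ii)] and (b) the explicit
construction of the number field `F_mod` in Example 5.1 [cf. (iii)]"; thinking of `𝔽_l` as a finite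
approximation of `ℤ` [Rmk 6.12.3], this relay between `𝔽_l^{⋊±}` [additive] and `𝔽_l^⋇`
[multiplicative] basepoints is "a sort of global combinatorial resolution of the two combinatorial
dimensions — i.e., additive and multiplicative [cf. [AbsTopIII], Remark 5.6.1] — of the ring `ℤ`";
and "it is especially natural to regard `𝔽_l` as a "good approximation" of `ℤ` when `l` is
"sufficiently large"" ([GenEll] §4; Rmk 3.1.2 (iv)). Heuristic summary (with Fig. 6.5, the
combinatorial structure of a `Θ^{±ell}NF`-Hodge theater = Def 6.13, abc-iut-L5-t4); nothing to type. -/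

end Literature.IUT.HodgeTheaters
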